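import Summits.Ventures.HodgeRepro2.T6N43Explicit

/-!
# T6N43ExplicitToy — non-vacuity of `N43_places_explicit` (README §10.5(ii)(c)/(d))

The accepted toys of T6N43Toy.lean realised as EXPLICIT local data: `N43Toy.explicitU11` = the
Cartan-line toy `toyU11` with its coefficient `cosh(η/2)^{−3}` produced by the Fock-line datum
`fockLineToy` (`E = ℂ`, `ω(η) = cosh(η/2)^{−3} • id`, `φ = f = 1`), `N43Toy.explicitU2` = the compact toy
`toyU2` with `ι = deltaCoeff`, `c = 1`, `m = 0`; the bundle `explicitToy : N43Places.ExplicitPlaces`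
satisfies the seven remaining binders of `N43_places_explicit` at once
(`explicit_binders_jointly_satisfiable`) and the theorem applies to it (`explicitToy_archNonvanishing`).
Axioms: {propext, Classical.choice, Quot.sound}. §8(d): uses an L-value-free non-vanishing device: NO.
-/

namespace Summit.Ventures.HodgeRepro2.T6

open MeasureTheory Complex
open scoped InnerProductSpace

namespace N43Toy

/-- The Fock-line datum realising the Cartan-line toy `toyU11`: `E = ℂ`, the action
`ω(η) = cosh(η(a_{η/2})/2)^{−3} • id`, `φ = f = 1` (`c = 1`). -/
noncomputable def fockLineToy : FockLineDatum ℝ ℂ where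
  ω η := ((Real.cosh ((2 * Real.arsinh ‖T5UnitaryBound.hyperbolicC (η / 2) 1 0‖) / 2) ^ (-3 : ℤ) : ℝ) : ℂ) •
    ContinuousLinearMap.id ℂ ℂ
  φ := 1
  f := 1
  c := 1
  hf := (one_smul ℂ (1 : ℂ)).symm

/-- The explicit (1,1)-place toy: `toyU11`'s measure and matrices, the Fock-line datum `fockLineToy`,
`toyU11`'s L-factor, weights and twist `0`. -/
noncomputable def explicitU11 : N43Places.ExplicitU11 where
  H := ℝ
  E := ℂ
  F := fockLineToy
  hφ := one_ne_zero
  hf := one_ne_zero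
  μ := toyU11.μ
  rep η := T5UnitaryBound.hyperbolicC (η / 2)
  rep_mem η := T5UnitaryBound.hyperbolicC_memU11 (η / 2)
  rep_measurable := measurable_hyperbolicC_entry
  Lfac := toyU11.Lfac
  τ := 0
  ν := 0
  r := 0

/-- The explicit toy's coefficient is `cosh(η/2)^{−3}` (the inner product `⟪1, k • 1⟫_ℂ = k`). -/
theorem explicitU11_coeffπ (g : ℝ) :
    explicitU11.datum.coeffπ g =
      ((Real.cosh ((2 * Real.arsinh ‖T5UnitaryBound.hyperbolicC (g / 2) 1 0‖) / 2) ^ (-3 : ℤ) : ℝ) : ℂ) := by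
  show ⟪(1 : ℂ), ((Real.cosh ((2 * Real.arsinh ‖T5UnitaryBound.hyperbolicC (g / 2) 1 0‖) / 2) ^ (-3 : ℤ) : ℝ) : ℂ) •
    (1 : ℂ)⟫_ℂ = _
  rw [inner_smul_right, inner_self_eq_norm_sq_to_K, norm_one, RCLike.ofReal_one, one_pow, mul_one]

/-- The explicit toy satisfies (I-P2′). -/
theorem explicitU11_lowest : explicitU11.datum.LowestWeightCoefficient := by
  show ∀ g : ℝ, ‖explicitU11.datum.coeffπ g‖ = ‖(1 : ℂ)‖ ^ 2 *
    Real.cosh ((2 * Real.arsinh ‖T5UnitaryBound.hyperbolicC (g / 2) 1 0‖) / 2) ^ (-3 : ℤ)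
  intro g
  rw [explicitU11_coeffπ g, norm_one, one_pow, one_mul, Complex.norm_real, Real.norm_eq_abs,
    abs_of_pos (zpow_pos (Real.cosh_pos _) _)]

/-- The explicit toy satisfies the (A-2f) display (transferred from `toyU11_A2f`: same measure, same
matrices). -/
theorem explicitU11_A2f : Hyp.Ruhl1970_A2f explicitU11.datum :=
  ArchDoublingDatum.ruhl_A2f_of_eq rfl rfl toyU11_A2f

/-- The explicit toy's `Lfac` is the Eischen–Liu product for weight (0; 0), twist 0. -/
theorem explicitU11_EL :
    Hyp.EischenLiu2024_Sec2_2 1 1 explicitU11.τ explicitU11.ν explicitU11.r explicitU11.Lfac :=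
  fun _ => rfl

/-- The explicit compact toy: the trivial group, `E = ℂ`, `ι = deltaCoeff`, `c = 1`, `m = 0`, the Dirac
probability measure, `rep = 1`, `toyU2`'s L-factor. -/
noncomputable def explicitU2 : N43Places.ExplicitU2 where
  H := Unit
  E := ℂ
  m := 0
  ι := deltaCoeff
  c := 1
  hι := by rw [deltaCoeff_Delta]; exact one_ne_zero
  hc := one_ne_zero
  μ := Measure.dirac ()
  prob := inferInstanceAs (IsProbabilityMeasure (Measure.dirac ()))
  rep _ := 1
  rep_mem _ := Submonoid.one_mem _
  rep_measurable _ _ := measurable_const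
  Lfac := toyU2.Lfac
  τ := 0
  ν := 0
  r := 0

/-- The explicit compact toy's `Lfac` is the Eischen–Liu product for `(a, b) = (2, 0)`, weight
`(0, 0; ∅)`, twist 0. -/
theorem explicitU2_EL :
    Hyp.EischenLiu2024_Sec2_2 2 0 explicitU2.τ explicitU2.ν explicitU2.r explicitU2.Lfac :=
  fun _ => rfl

/-- The explicit toy bundle. -/
noncomputable def explicitToy : N43Places.ExplicitPlaces where
  p₁ := explicitU2
  p₂ := explicitU11
  p₃ := explicitU11

/-- README §10.5(ii)(c)/(d) for `N43_places_explicit`: its seven binders are jointly satisfiable on the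
explicit toy bundle. -/
theorem explicit_binders_jointly_satisfiable :
    ∃ X : N43Places.ExplicitPlaces,
      Hyp.EischenLiu2024_Sec2_2 2 0 X.p₁.τ X.p₁.ν X.p₁.r X.p₁.Lfac ∧
      X.p₂.datum.LowestWeightCoefficient ∧ Hyp.Ruhl1970_A2f X.p₂.datum ∧
      Hyp.EischenLiu2024_Sec2_2 1 1 X.p₂.τ X.p₂.ν X.p₂.r X.p₂.Lfac ∧
      X.p₃.datum.LowestWeightCoefficient ∧ Hyp.Ruhl1970_A2f X.p₃.datum ∧
      Hyp.EischenLiu2024_Sec2_2 1 1 X.p₃.τ X.p₃.ν X.p₃.r X.p₃.Lfac :=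
  ⟨explicitToy, explicitU2_EL, explicitU11_lowest, explicitU11_A2f, explicitU11_EL,
    explicitU11_lowest, explicitU11_A2f, explicitU11_EL⟩

/-- The theorem applied to the explicit toy bundle. -/
theorem explicitToy_archNonvanishing : explicitToy.toPlaces.ArchNonvanishing :=
  explicitToy.archNonvanishing_explicit explicitU2_EL explicitU11_lowest explicitU11_A2f
    explicitU11_EL explicitU11_lowest explicitU11_A2f explicitU11_EL

end N43Toy

end Summit.Ventures.HodgeRepro2.T6
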